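import Summits.RiemannHypothesis.RiemannHypothesis.Theorems.DBNFarFieldTaylor
import HarnessLib

/-!
# RiemannHypothesis / DBN — near-field and far-field bounds of the boundary probe kernel (soundness of the T6′ checker, II)

Route `RiemannHypothesis/DBN`, column DBN (D-0040 record-keeping; cell `pub-dbn`).  Proofs only:
* `cells_bound` / `near_bound`: on a `ξ`-interval `|ξ-ξc| ≤ h`, `(2/c)·S_{c,κ}(ξ,1) ≤ C(ξ-ξc) + ρ` with
  `(C, ρ) = nearData …` (sum of `cell_bound` over the cells of a checked partition of `[-1,1]` and over
  the two Cauchy kernels `a = c ∓ 1`);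
* `probeKernel_neg`: evenness `S(-ξ,1) = S(ξ,1)`;
* `far_cell`, `far_ineq_i…v`, `far_bound`: for `ξ ≥ X ≥ 2κ`, the order-6 expansion on the whole cell
  with the exact cancellation of the `ξ⁻²` terms at `m = 2/c` gives
  `D(ξ)·ξ⁴ ≥ Ψ₀ - m₆/ξ² - C₇/ξ³ - 256/ξ⁴ - C₁₀/ξ⁶`, hence `(2/c)S ≤ 4/(ξ²+4)` once `farCheck c κ X`.
RH-FREE real analysis; `--supports stmt-RiemannHypothesis-0274`; nothing here bears on the truth of RH.
-/

-- D-0017: `Summit.<S>.<S>.…` is the designed namespace of a single-problem summit.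
set_option linter.dupNamespace false

open MeasureTheory Set intervalIntegral
open scoped Real

namespace Summit.RiemannHypothesis.RiemannHypothesis.Theorems.DbnTheory

namespace FarField

section Near

/-- The head of a checked partition tail is `≤ 1`. -/
theorem ptsCheck_head_le : ∀ (p : ℝ) (L : List ℝ), ptsCheck (p :: L) = true → p ≤ 1
  | p, [], h => by
      have : p = 1 := by simpa [ptsCheck] using h
      exact this.le
  | p, b :: L, h => by
      simp only [ptsCheck, Bool.and_eq_true, decide_eq_true_eq] at h
      exact h.1.le.trans (ptsCheck_head_le b L h.2)

/-- **Near-field bound over a checked partition** (induction over the cells, `cell_bound` per cell and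
per kernel `a ∈ {c-1, c+1}`). -/
theorem cells_bound {c κ xc h ξ : ℝ} (hc : 1 < c) (hκ : 0 ≤ κ) (N' : ℕ) (ht : |ξ - xc| ≤ h) :
    ∀ (L : List ℝ) (p : ℝ), ptsCheck (p :: L) = true → -1 ≤ p →
      (2 / c) * ∫ v in p..1, biweight v * ((c - 1) / ((c - 1) ^ 2 + (ξ - 0 - κ * v) ^ 2)
          + (c + 1) / ((c + 1) ^ 2 + (ξ - 0 - κ * v) ^ 2)) ≤
        peval (nearData c κ N' xc h (cellsOf (p :: L))).1 (ξ - xc)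
          + (nearData c κ N' xc h (cellsOf (p :: L))).2
  | [], p, hchk, _ => by
      have hp1 : p = 1 := by simpa [ptsCheck] using hchk
      subst hp1
      simp [cellsOf, nearData, intervalIntegral.integral_same]
  | b :: L, p, hchk, hp => by
      simp only [ptsCheck, Bool.and_eq_true, decide_eq_true_eq] at hchk
      obtain ⟨hpb, hrest⟩ := hchk
      have hb1 : b ≤ 1 := ptsCheck_head_le b L hrest
      have ih := cells_bound hc hκ N' ht L b hrest (by linarith)
      have hc1 : 0 < c - 1 := by linarith
      have hc2 : 0 < c + 1 := by linarith
      have hcont : Continuous (fun v => biweight v * ((c - 1) / ((c - 1) ^ 2 + (ξ - 0 - κ * v) ^ 2)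
          + (c + 1) / ((c + 1) ^ 2 + (ξ - 0 - κ * v) ^ 2))) := by
        refine continuous_biweight.mul (Continuous.add ?_ ?_)
        · exact continuous_const.div (by fun_prop) (fun v => by positivity)
        · exact continuous_const.div (by fun_prop) (fun v => by positivity)
      rw [← intervalIntegral.integral_add_adjacent_intervals (hcont.intervalIntegrable p b)
        (hcont.intervalIntegrable b 1)]
      have h1 := cell_bound (a := c - 1) (κ := κ) (α := p) (β := b) (xc := xc) hc1 hκ hpb.le hp hb1 N' ht
      have h2 := cell_bound (a := c + 1) (κ := κ) (α := p) (β := b) (xc := xc) hc2 hκ hpb.le hp hb1 N' ht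
      have hcg1 : Continuous (fun v => biweight v * ((c - 1) / ((c - 1) ^ 2 + (ξ - 0 - κ * v) ^ 2))) :=
        continuous_biweight.mul (continuous_const.div (by fun_prop) (fun v => by positivity))
      have hcg2 : Continuous (fun v => biweight v * ((c + 1) / ((c + 1) ^ 2 + (ξ - 0 - κ * v) ^ 2))) :=
        continuous_biweight.mul (continuous_const.div (by fun_prop) (fun v => by positivity))
      have hsplit : ∫ v in p..b, biweight v * ((c - 1) / ((c - 1) ^ 2 + (ξ - 0 - κ * v) ^ 2)
          + (c + 1) / ((c + 1) ^ 2 + (ξ - 0 - κ * v) ^ 2)) =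
          (∫ v in p..b, biweight v * ((c - 1) / ((c - 1) ^ 2 + (ξ - 0 - κ * v) ^ 2))) +
          ∫ v in p..b, biweight v * ((c + 1) / ((c + 1) ^ 2 + (ξ - 0 - κ * v) ^ 2)) := by
        rw [← intervalIntegral.integral_add (hcg1.intervalIntegrable p b) (hcg2.intervalIntegrable p b)]
        congr 1; funext v; ring
      simp only [cellsOf, nearData, peval_padd, peval_psmul]
      rw [hsplit]
      have h2c : 0 ≤ 2 / c := by positivity
      have h12 := mul_le_mul_of_nonneg_left (add_le_add h1 h2) h2c
      linarith

/-- The near-field bound for the probe kernel on one `ξ`-interval. -/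
theorem near_bound {c κ xc h ξ : ℝ} (hc : 1 < c) (hκ : 0 ≤ κ) (N' : ℕ) (ht : |ξ - xc| ≤ h)
    (L : List ℝ) (hchk : ptsCheck ((-1) :: L) = true) :
    (2 / c) * probeKernel c κ 0 ξ 1 ≤
      peval (nearData c κ N' xc h (cellsOf ((-1) :: L))).1 (ξ - xc)
        + (nearData c κ N' xc h (cellsOf ((-1) :: L))).2 := by
  rw [probeKernel_one]
  exact cells_bound hc hκ N' ht L (-1) hchk le_rfl

/-- Evenness of the boundary kernel in `ξ` (substitute `v ↦ -v`; the biweight is even). -/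
theorem probeKernel_neg (c κ ξ : ℝ) : probeKernel c κ 0 (-ξ) 1 = probeKernel c κ 0 ξ 1 := by
  rw [probeKernel_one, probeKernel_one]
  have h := intervalIntegral.integral_comp_neg (a := (-1 : ℝ)) (b := 1)
    (fun v => biweight v * ((c - 1) / ((c - 1) ^ 2 + (ξ - 0 - κ * v) ^ 2)
      + (c + 1) / ((c + 1) ^ 2 + (ξ - 0 - κ * v) ^ 2)))
  simp only [neg_neg] at h
  rw [← h]
  refine intervalIntegral.integral_congr fun v _ => ?_
  simp only [biweight_eq_max, neg_sq]
  ring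

end Near

section Far

/-- The whole-cell far-field bound of one Cauchy kernel (`N = 6`, centre `s₀ = ξ`, `ξ > κ ≥ 0`). -/
theorem far_cell {a κ ξ : ℝ} (ha : 0 < a) (hκ : 0 ≤ κ) (hξκ : κ < ξ) :
    ∫ v in (-1:ℝ)..1, biweight v * (a / (a ^ 2 + (ξ - 0 - κ * v) ^ 2)) ≤
      a / (ξ ^ 2 + a ^ 2) + κ ^ 2 / 7 * ((3 * ξ ^ 2 * a - a ^ 3) / (ξ ^ 2 + a ^ 2) ^ 3)
        + κ ^ 4 / 21 * ((5 * ξ ^ 4 * a - 10 * ξ ^ 2 * a ^ 3 + a ^ 5) / (ξ ^ 2 + a ^ 2) ^ 5)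
        + κ ^ 6 * (5 / 231) / ((ξ ^ 2 + a ^ 2) ^ 3 * (ξ - κ)) := by
  have hξ : 0 < ξ := lt_of_le_of_lt hκ hξκ
  set D := (ξ ^ 2 + a ^ 2) ^ 3 with hD
  have hDpos : 0 < D := by positivity
  have hxk : 0 < ξ - κ := by linarith
  -- pointwise majorant on [-1,1]
  have hpt : ∀ v ∈ Icc (-1:ℝ) 1, biweight v * (a / (a ^ 2 + (ξ - 0 - κ * v) ^ 2)) ≤
      biweight v * (∑ n ∈ Finset.range (2 * 3), (ξ - (ξ - 0 - κ * v)) ^ n * tcoef ξ a n)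
        + biweight v * ((κ * v) ^ 6 / (D * (ξ - κ))) := by
    intro v hv
    obtain ⟨R, hR, -, hR2⟩ := cauchy_taylor a ξ (ξ - 0 - κ * v) ha.ne' 3
    rw [hR, mul_add]
    have hbw := biweight_nonneg v
    have hs : ξ - κ ≤ ξ - 0 - κ * v := by nlinarith [hv.2]
    have hspos : 0 < ξ - 0 - κ * v := lt_of_lt_of_le hxk hs
    have he : |ξ - 0 - κ * v - ξ| ^ (2 * 3) = (κ * v) ^ 6 := by
      rw [show ξ - 0 - κ * v - ξ = -(κ * v) by ring, abs_neg]
      exact Even.pow_abs ⟨3, rfl⟩ (κ * v)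
    rw [he, abs_of_pos hspos] at hR2
    have hkv : 0 ≤ (κ * v) ^ 6 := by positivity
    have h3 : R ≤ (κ * v) ^ 6 / (D * (ξ - κ)) := by
      have hR' : |R| ≤ (κ * v) ^ 6 / ((ξ - 0 - κ * v) * D) := by
        rw [le_div_iff₀ (by positivity)]
        calc |R| * ((ξ - 0 - κ * v) * D) = |R| * (ξ - 0 - κ * v) * (ξ ^ 2 + a ^ 2) ^ 3 := by
              rw [hD]; ring
          _ ≤ (κ * v) ^ 6 := hR2
      calc R ≤ |R| := le_abs_self R
        _ ≤ (κ * v) ^ 6 / ((ξ - 0 - κ * v) * D) := hR'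
        _ ≤ (κ * v) ^ 6 / (D * (ξ - κ)) := by
          apply div_le_div_of_nonneg_left hkv (by positivity)
          rw [mul_comm]
          exact mul_le_mul_of_nonneg_right hs hDpos.le
    gcongr
  have hint_l : IntervalIntegrable (fun v => biweight v * (a / (a ^ 2 + (ξ - 0 - κ * v) ^ 2)))
      volume (-1) 1 :=
    (continuous_biweight.mul (continuous_const.div (by fun_prop) (fun v => by positivity))).intervalIntegrable _ _
  have hcont1 : Continuous (fun v => biweight v *
      (∑ n ∈ Finset.range (2 * 3), (ξ - (ξ - 0 - κ * v)) ^ n * tcoef ξ a n)) :=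
    continuous_biweight.mul (continuous_finsetSum _ fun n _ => by fun_prop)
  have hcont2 : Continuous (fun v => biweight v * ((κ * v) ^ 6 / (D * (ξ - κ)))) :=
    continuous_biweight.mul (by fun_prop)
  have hint_r : IntervalIntegrable (fun v => biweight v *
      (∑ n ∈ Finset.range (2 * 3), (ξ - (ξ - 0 - κ * v)) ^ n * tcoef ξ a n)
        + biweight v * ((κ * v) ^ 6 / (D * (ξ - κ)))) volume (-1) 1 :=
    (hcont1.add hcont2).intervalIntegrable _ _
  have hmono := intervalIntegral.integral_mono_on (by norm_num) hint_l hint_r (fun v hv => hpt v hv)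
  refine hmono.trans (le_of_eq ?_)
  rw [intervalIntegral.integral_add (hcont1.intervalIntegrable _ _) (hcont2.intervalIntegrable _ _)]
  -- moments of the whole cell
  have hm : ∀ k : ℕ, ∫ v in (-1:ℝ)..1, biweight v * v ^ k = bmoment (-1) 1 k := by
    intro k
    have := integral_biweight_mul_pow (α := -1) (β := 1) le_rfl le_rfl (by norm_num) k
    simpa using this
  have hmain : ∫ v in (-1:ℝ)..1, biweight v *
      (∑ n ∈ Finset.range (2 * 3), (ξ - (ξ - 0 - κ * v)) ^ n * tcoef ξ a n) =
      ∑ n ∈ Finset.range (2 * 3), tcoef ξ a n * κ ^ n * bmoment (-1) 1 n := by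
    have hfun : (fun v => biweight v *
        (∑ n ∈ Finset.range (2 * 3), (ξ - (ξ - 0 - κ * v)) ^ n * tcoef ξ a n)) = fun v =>
        ∑ n ∈ Finset.range (2 * 3), (tcoef ξ a n * κ ^ n) * (biweight v * v ^ n) := by
      funext v
      rw [Finset.mul_sum]
      refine Finset.sum_congr rfl fun n _ => ?_
      rw [show ξ - (ξ - 0 - κ * v) = κ * v by ring, mul_pow]; ring
    rw [hfun, intervalIntegral.integral_finsetSum]
    · refine Finset.sum_congr rfl fun n _ => ?_
      rw [intervalIntegral.integral_const_mul, hm]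
    · intro n _
      exact (continuous_const.mul (continuous_biweight.mul (continuous_pow n))).intervalIntegrable _ _
  have hrem : ∫ v in (-1:ℝ)..1, biweight v * ((κ * v) ^ 6 / (D * (ξ - κ))) =
      κ ^ 6 / (D * (ξ - κ)) * bmoment (-1) 1 6 := by
    have hfun : (fun v => biweight v * ((κ * v) ^ 6 / (D * (ξ - κ)))) =
        fun v => κ ^ 6 / (D * (ξ - κ)) * (biweight v * v ^ 6) := by
      funext v; rw [mul_pow]; ring
    rw [hfun, intervalIntegral.integral_const_mul, hm]
  rw [hmain, hrem]
  have hm0 : bmoment (-1:ℝ) 1 0 = 1 := by norm_num [bmoment, monoInt]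
  have hm1 : bmoment (-1:ℝ) 1 1 = 0 := by norm_num [bmoment, monoInt]
  have hm2 : bmoment (-1:ℝ) 1 2 = 1 / 7 := by norm_num [bmoment, monoInt]
  have hm3 : bmoment (-1:ℝ) 1 3 = 0 := by norm_num [bmoment, monoInt]
  have hm4 : bmoment (-1:ℝ) 1 4 = 1 / 21 := by norm_num [bmoment, monoInt]
  have hm5 : bmoment (-1:ℝ) 1 5 = 0 := by norm_num [bmoment, monoInt]
  have hm6 : bmoment (-1:ℝ) 1 6 = 5 / 231 := by norm_num [bmoment, monoInt]
  simp only [Finset.sum_range_succ, Finset.sum_range_zero, hm0, hm1, hm2, hm3, hm4, hm5, hm6,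
    tcoef, cpow]
  have hξa : ξ ^ 2 + a ^ 2 ≠ 0 := by positivity
  rw [hD]
  field_simp
  ring

/-- Elementary far-field inequalities (all for `ξ > 0`, `a > 0`). -/
theorem far_ineq_i {a ξ : ℝ} (ha : 0 < a) (hξ : 0 < ξ) :
    a / (ξ ^ 2 + a ^ 2) ≤ a / ξ ^ 2 - a ^ 3 / ξ ^ 4 + a ^ 5 / ξ ^ 6 := by
  have key : a / ξ ^ 2 - a ^ 3 / ξ ^ 4 + a ^ 5 / ξ ^ 6 - a / (ξ ^ 2 + a ^ 2)
      = a ^ 7 / (ξ ^ 6 * (ξ ^ 2 + a ^ 2)) := by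
    field_simp; ring
  have : 0 ≤ a ^ 7 / (ξ ^ 6 * (ξ ^ 2 + a ^ 2)) := by positivity
  linarith

/-- see `far_ineq_i` -/
theorem far_ineq_ii {a ξ : ℝ} (ha : 0 < a) (hξ : 0 < ξ) :
    (3 * ξ ^ 2 * a - a ^ 3) / (ξ ^ 2 + a ^ 2) ^ 3 ≤ 3 * a / ξ ^ 4 := by
  have key : 3 * a / ξ ^ 4 - (3 * ξ ^ 2 * a - a ^ 3) / (ξ ^ 2 + a ^ 2) ^ 3
      = (10 * a ^ 3 * ξ ^ 4 + 9 * a ^ 5 * ξ ^ 2 + 3 * a ^ 7) / (ξ ^ 4 * (ξ ^ 2 + a ^ 2) ^ 3) := by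
    field_simp; ring
  have : 0 ≤ (10 * a ^ 3 * ξ ^ 4 + 9 * a ^ 5 * ξ ^ 2 + 3 * a ^ 7) / (ξ ^ 4 * (ξ ^ 2 + a ^ 2) ^ 3) := by
    positivity
  linarith

/-- see `far_ineq_i` -/
theorem far_ineq_iii {a ξ : ℝ} (ha : 0 < a) (hξ : 0 < ξ) :
    (5 * ξ ^ 4 * a - 10 * ξ ^ 2 * a ^ 3 + a ^ 5) / (ξ ^ 2 + a ^ 2) ^ 5 ≤
      5 * a / ξ ^ 6 + a ^ 5 / ξ ^ 10 := by
  have key : 5 * a / ξ ^ 6 + a ^ 5 / ξ ^ 10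
      - (5 * ξ ^ 4 * a - 10 * ξ ^ 2 * a ^ 3 + a ^ 5) / (ξ ^ 2 + a ^ 2) ^ 5
      = (35 * a ^ 3 * ξ ^ 12 + 50 * a ^ 5 * ξ ^ 10 + 55 * a ^ 7 * ξ ^ 8 + 35 * a ^ 9 * ξ ^ 6
          + 15 * a ^ 11 * ξ ^ 4 + 5 * a ^ 13 * ξ ^ 2 + a ^ 15) / (ξ ^ 10 * (ξ ^ 2 + a ^ 2) ^ 5) := by
    field_simp; ring
  have : 0 ≤ (35 * a ^ 3 * ξ ^ 12 + 50 * a ^ 5 * ξ ^ 10 + 55 * a ^ 7 * ξ ^ 8 + 35 * a ^ 9 * ξ ^ 6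
          + 15 * a ^ 11 * ξ ^ 4 + 5 * a ^ 13 * ξ ^ 2 + a ^ 15) / (ξ ^ 10 * (ξ ^ 2 + a ^ 2) ^ 5) := by
    positivity
  linarith

/-- see `far_ineq_i` -/
theorem far_ineq_iv {a κ ξ : ℝ} (hξ : 0 < ξ) (h2 : 2 * κ ≤ ξ) :
    κ ^ 6 * (5 / 231) / ((ξ ^ 2 + a ^ 2) ^ 3 * (ξ - κ)) ≤ 10 * κ ^ 6 / (231 * ξ ^ 7) := by
  have hxk : 0 < ξ - κ := by linarith
  have hden : ξ ^ 6 * (ξ / 2) ≤ (ξ ^ 2 + a ^ 2) ^ 3 * (ξ - κ) := by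
    apply mul_le_mul _ (by linarith) (by positivity) (by positivity)
    have : ξ ^ 2 ≤ ξ ^ 2 + a ^ 2 := by nlinarith [sq_nonneg a]
    calc ξ ^ 6 = (ξ ^ 2) ^ 3 := by ring
      _ ≤ (ξ ^ 2 + a ^ 2) ^ 3 := pow_le_pow_left₀ (by positivity) this 3
  calc κ ^ 6 * (5 / 231) / ((ξ ^ 2 + a ^ 2) ^ 3 * (ξ - κ))
      ≤ κ ^ 6 * (5 / 231) / (ξ ^ 6 * (ξ / 2)) :=
        div_le_div_of_nonneg_left (by positivity) (by positivity) hden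
    _ = 10 * κ ^ 6 / (231 * ξ ^ 7) := by field_simp; ring

/-- see `far_ineq_i` -/
theorem far_ineq_v {ξ : ℝ} (hξ : 0 < ξ) :
    4 / ξ ^ 2 - 16 / ξ ^ 4 + 64 / ξ ^ 6 - 256 / ξ ^ 8 ≤ 4 / (ξ ^ 2 + 4) := by
  have key : 4 / (ξ ^ 2 + 4) - (4 / ξ ^ 2 - 16 / ξ ^ 4 + 64 / ξ ^ 6 - 256 / ξ ^ 8)
      = 1024 / (ξ ^ 8 * (ξ ^ 2 + 4)) := by
    field_simp; ring
  have : 0 ≤ 1024 / (ξ ^ 8 * (ξ ^ 2 + 4)) := by positivity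
  linarith

/-- **Far-field bound.**  If `2κ ≤ X`, `0 < X` and
`farM6/X² + farC7/X³ + 256/X⁴ + farC10/X⁶ < farPsi` (all at `(c,κ)`), then
`(2/c)·S_{c,κ}(ξ,1) ≤ 4/(ξ²+4)` for every `ξ ≥ X`. -/
theorem far_bound {c κ X : ℝ} (hc : 1 < c) (hκ : 0 ≤ κ) (h2 : 2 * κ ≤ X) (hX : 0 < X)
    (hineq : farM6 c κ / X ^ 2 + farC7 c κ / X ^ 3 + 256 / X ^ 4 + farC10 c κ / X ^ 6 < farPsi c κ)
    {ξ : ℝ} (hξ : X ≤ ξ) : (2 / c) * probeKernel c κ 0 ξ 1 ≤ 4 / (ξ ^ 2 + 4) := by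
  have hξ0 : 0 < ξ := lt_of_lt_of_le hX hξ
  have h2ξ : 2 * κ ≤ ξ := h2.trans hξ
  have hκξ : κ < ξ := by linarith
  have hc0 : 0 < c := by linarith
  have hc1 : 0 < c - 1 := by linarith
  have hc2 : 0 < c + 1 := by linarith
  rw [probeKernel_one]
  have hcg1 : Continuous (fun v => biweight v * ((c - 1) / ((c - 1) ^ 2 + (ξ - 0 - κ * v) ^ 2))) :=
    continuous_biweight.mul (continuous_const.div (by fun_prop) (fun v => by positivity))
  have hcg2 : Continuous (fun v => biweight v * ((c + 1) / ((c + 1) ^ 2 + (ξ - 0 - κ * v) ^ 2))) :=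
    continuous_biweight.mul (continuous_const.div (by fun_prop) (fun v => by positivity))
  have hsplit : ∫ v in (-1:ℝ)..1, biweight v * ((c - 1) / ((c - 1) ^ 2 + (ξ - 0 - κ * v) ^ 2)
      + (c + 1) / ((c + 1) ^ 2 + (ξ - 0 - κ * v) ^ 2)) =
      (∫ v in (-1:ℝ)..1, biweight v * ((c - 1) / ((c - 1) ^ 2 + (ξ - 0 - κ * v) ^ 2))) +
      ∫ v in (-1:ℝ)..1, biweight v * ((c + 1) / ((c + 1) ^ 2 + (ξ - 0 - κ * v) ^ 2)) := by
    rw [← intervalIntegral.integral_add (hcg1.intervalIntegrable _ _) (hcg2.intervalIntegrable _ _)]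
    congr 1; funext v; ring
  rw [hsplit]
  have B1 := far_cell hc1 hκ hκξ
  have B2 := far_cell hc2 hκ hκξ
  -- simple majorants of the four pieces for each kernel
  have U1 := far_ineq_i hc1 hξ0
  have U2 := far_ineq_i hc2 hξ0
  have V1 := far_ineq_ii hc1 hξ0
  have V2 := far_ineq_ii hc2 hξ0
  have W1 := far_ineq_iii hc1 hξ0
  have W2 := far_ineq_iii hc2 hξ0
  have Z1 := far_ineq_iv (a := c - 1) hξ0 h2ξ
  have Z2 := far_ineq_iv (a := c + 1) hξ0 h2ξ
  have P := far_ineq_v hξ0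
  have hk2 : 0 ≤ κ ^ 2 / 7 := by positivity
  have hk4 : 0 ≤ κ ^ 4 / 21 := by positivity
  -- the combined Laurent bound
  have hsum : (2 / c) * ((((c - 1) / ξ ^ 2 - (c - 1) ^ 3 / ξ ^ 4 + (c - 1) ^ 5 / ξ ^ 6)
        + κ ^ 2 / 7 * (3 * (c - 1) / ξ ^ 4) + κ ^ 4 / 21 * (5 * (c - 1) / ξ ^ 6 + (c - 1) ^ 5 / ξ ^ 10)
        + 10 * κ ^ 6 / (231 * ξ ^ 7))
      + (((c + 1) / ξ ^ 2 - (c + 1) ^ 3 / ξ ^ 4 + (c + 1) ^ 5 / ξ ^ 6)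
        + κ ^ 2 / 7 * (3 * (c + 1) / ξ ^ 4) + κ ^ 4 / 21 * (5 * (c + 1) / ξ ^ 6 + (c + 1) ^ 5 / ξ ^ 10)
        + 10 * κ ^ 6 / (231 * ξ ^ 7)))
      = (4 / ξ ^ 2 - 16 / ξ ^ 4 + 64 / ξ ^ 6 - 256 / ξ ^ 8)
        - (farPsi c κ / ξ ^ 4
          + (64 - (2 / c) * (((c - 1) ^ 5 + (c + 1) ^ 5) + 5 * κ ^ 4 / 21 * ((c - 1) + (c + 1)))) / ξ ^ 6
          - farC7 c κ / ξ ^ 7 - 256 / ξ ^ 8 - farC10 c κ / ξ ^ 10) := by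
    simp only [farPsi, farC7, farC10]
    field_simp
    ring
  -- positivity of the bracket
  have hM6 : 0 ≤ farM6 c κ := le_max_left _ _
  have hM6' : -(farM6 c κ) ≤
      64 - (2 / c) * (((c - 1) ^ 5 + (c + 1) ^ 5) + 5 * κ ^ 4 / 21 * ((c - 1) + (c + 1))) := by
    have := le_max_right 0
      ((2 / c) * (((c - 1) ^ 5 + (c + 1) ^ 5) + 5 * κ ^ 4 / 21 * ((c - 1) + (c + 1))) - 64)
    simp only [farM6]; linarith
  have hC7 : 0 ≤ farC7 c κ := by simp only [farC7]; positivity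
  have hC10 : 0 ≤ farC10 c κ := by
    simp only [farC10]
    have : 0 ≤ (c - 1) ^ 5 + (c + 1) ^ 5 := by positivity
    positivity
  have hx2 : farM6 c κ / ξ ^ 2 ≤ farM6 c κ / X ^ 2 :=
    div_le_div_of_nonneg_left hM6 (by positivity) (pow_le_pow_left₀ hX.le hξ 2)
  have hx3 : farC7 c κ / ξ ^ 3 ≤ farC7 c κ / X ^ 3 :=
    div_le_div_of_nonneg_left hC7 (by positivity) (pow_le_pow_left₀ hX.le hξ 3)
  have hx4 : (256:ℝ) / ξ ^ 4 ≤ 256 / X ^ 4 :=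
    div_le_div_of_nonneg_left (by norm_num) (by positivity) (pow_le_pow_left₀ hX.le hξ 4)
  have hx6 : farC10 c κ / ξ ^ 6 ≤ farC10 c κ / X ^ 6 :=
    div_le_div_of_nonneg_left hC10 (by positivity) (pow_le_pow_left₀ hX.le hξ 6)
  have hbr : 0 < farPsi c κ - farM6 c κ / ξ ^ 2 - farC7 c κ / ξ ^ 3 - 256 / ξ ^ 4 - farC10 c κ / ξ ^ 6 := by
    linarith
  have hkey : 0 ≤ farPsi c κ / ξ ^ 4
          + (64 - (2 / c) * (((c - 1) ^ 5 + (c + 1) ^ 5) + 5 * κ ^ 4 / 21 * ((c - 1) + (c + 1)))) / ξ ^ 6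
          - farC7 c κ / ξ ^ 7 - 256 / ξ ^ 8 - farC10 c κ / ξ ^ 10 := by
    have hξ4 : 0 < ξ ^ 4 := by positivity
    have hξ6 : 0 < ξ ^ 6 := by positivity
    have step1 : -(farM6 c κ) / ξ ^ 6 ≤
        (64 - (2 / c) * (((c - 1) ^ 5 + (c + 1) ^ 5) + 5 * κ ^ 4 / 21 * ((c - 1) + (c + 1)))) / ξ ^ 6 :=
      div_le_div_of_nonneg_right hM6' hξ6.le
    have step2 : farPsi c κ / ξ ^ 4 + -(farM6 c κ) / ξ ^ 6 - farC7 c κ / ξ ^ 7 - 256 / ξ ^ 8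
        - farC10 c κ / ξ ^ 10 =
        (farPsi c κ - farM6 c κ / ξ ^ 2 - farC7 c κ / ξ ^ 3 - 256 / ξ ^ 4 - farC10 c κ / ξ ^ 6) / ξ ^ 4 := by
      field_simp; ring
    have step3 : 0 < (farPsi c κ - farM6 c κ / ξ ^ 2 - farC7 c κ / ξ ^ 3 - 256 / ξ ^ 4
        - farC10 c κ / ξ ^ 6) / ξ ^ 4 := div_pos hbr hξ4
    linarith
  have h2c : 0 ≤ 2 / c := by positivity
  -- chain
  have hB : (2 / c) * ((∫ v in (-1:ℝ)..1, biweight v * ((c - 1) / ((c - 1) ^ 2 + (ξ - 0 - κ * v) ^ 2)))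
      + ∫ v in (-1:ℝ)..1, biweight v * ((c + 1) / ((c + 1) ^ 2 + (ξ - 0 - κ * v) ^ 2))) ≤
      (2 / c) * ((((c - 1) / ξ ^ 2 - (c - 1) ^ 3 / ξ ^ 4 + (c - 1) ^ 5 / ξ ^ 6)
        + κ ^ 2 / 7 * (3 * (c - 1) / ξ ^ 4) + κ ^ 4 / 21 * (5 * (c - 1) / ξ ^ 6 + (c - 1) ^ 5 / ξ ^ 10)
        + 10 * κ ^ 6 / (231 * ξ ^ 7))
      + (((c + 1) / ξ ^ 2 - (c + 1) ^ 3 / ξ ^ 4 + (c + 1) ^ 5 / ξ ^ 6)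
        + κ ^ 2 / 7 * (3 * (c + 1) / ξ ^ 4) + κ ^ 4 / 21 * (5 * (c + 1) / ξ ^ 6 + (c + 1) ^ 5 / ξ ^ 10)
        + 10 * κ ^ 6 / (231 * ξ ^ 7))) := by
    apply mul_le_mul_of_nonneg_left _ h2c
    have T1 := mul_le_mul_of_nonneg_left V1 hk2
    have T2 := mul_le_mul_of_nonneg_left V2 hk2
    have T3 := mul_le_mul_of_nonneg_left W1 hk4
    have T4 := mul_le_mul_of_nonneg_left W2 hk4
    linarith
  rw [hsum] at hB
  linarith

end Far

end FarField

end Summit.RiemannHypothesis.RiemannHypothesis.Theorems.DbnTheory
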